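import Mathlib

/-!
# Fano loci are closed in the classical topology (crux `BeyondHessianNs`)

Helper file for crux item stmt-ValiantsHypothesis-5641 (`RefutationDegree.BeyondHessianNs`),
stub `stub_fanoClosed` of the line `Sketch`.

Let `F` be a finite set of exponents `μ : σ →₀ ℕ` on a finite variable type `σ`, `k : ℕ`, and `S`
a set of coefficient vectors `c : F → ℂ` such that each polynomial `x ↦ Σ_{μ ∈ F} c_μ x^μ`
vanishes identically on SOME linear subspace of `ℂ^σ` of dimension `≥ k`. Then the same holds for
every `c₀` in the closure of `S` (product topology of `F → ℂ`).

Proof (compactness of the Stiefel variety of orthonormal frames):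
* `isCompact_setOf_orthonormal` — in a finite-dimensional complex inner product space `E` the set
  of orthonormal `k`-frames `b : Fin k → E` is compact (closed: finitely many equations
  `⟪b i, b j⟫ = δ_{ij}`; bounded: `‖b i‖ = 1`; `Fin k → E` is proper).
* `exists_orthonormal_of_le_finrank` — a subspace of dimension `≥ k` contains an orthonormal
  `k`-frame (the first `k` vectors of `stdOrthonormalBasis`).
* `exists_submodule_of_mem_closure` — the abstract statement for a jointly continuous
  `f : X × E → ℂ` (`X` Fréchet–Urysohn): approximate `c₀` by a sequence `c_j ∈ S`, choose
  orthonormal `k`-frames `b_j` inside the subspaces on which `f (c_j, ·)` vanishes, extract a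
  convergent subsequence `b_{φ j} → β` (`IsCompact.tendsto_subseq`), and pass to the limit in
  `f (c_{φ j}, Σ_i t_i • b_{φ j} i) = 0`; the orthonormal limit frame `β` spans a subspace of
  dimension exactly `k` (`finrank_span_eq_card`).
* `stub_fanoClosed` — transport along the continuous linear equivalence
  `EuclideanSpace.equiv σ ℂ : EuclideanSpace ℂ σ ≃L[ℂ] (σ → ℂ)` (`LinearEquiv.finrank_map_eq`).
-/

noncomputable section

-- single-conjunct layout: Sub = Summit, duplicated namespace component intended
set_option linter.dupNamespace false

namespace Summit.ValiantsHypothesis.ValiantsHypothesis.Theorems.RefutationDegreeBeyondHessianNs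

open Filter Topology

/-- The set of orthonormal `k`-frames in a finite-dimensional complex inner product space is
compact (it is closed and bounded in the proper space `Fin k → E`). [folklore] -/
theorem isCompact_setOf_orthonormal {E : Type*} [NormedAddCommGroup E] [InnerProductSpace ℂ E]
    [FiniteDimensional ℂ E] (k : ℕ) :
    IsCompact {b : Fin k → E | Orthonormal ℂ b} := by
  have hclosed : IsClosed {b : Fin k → E | Orthonormal ℂ b} := by
    simp only [orthonormal_iff_ite, Set.setOf_forall]
    exact isClosed_iInter fun i => isClosed_iInter fun j =>
      isClosed_eq ((continuous_apply i).inner (continuous_apply j)) continuous_const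
  refine (isCompact_closedBall (0 : Fin k → E) 1).of_isClosed_subset hclosed ?_
  intro b hb
  rw [Metric.mem_closedBall, dist_zero_right, pi_norm_le_iff_of_nonneg zero_le_one]
  exact fun i => (hb.1 i).le

/-- A subspace of dimension `≥ k` of a finite-dimensional complex inner product space contains an
orthonormal `k`-frame (the first `k` vectors of its standard orthonormal basis). [folklore] -/
theorem exists_orthonormal_of_le_finrank {E : Type*} [NormedAddCommGroup E]
    [InnerProductSpace ℂ E] [FiniteDimensional ℂ E] {k : ℕ} (V : Submodule ℂ E)
    (hk : k ≤ Module.finrank ℂ V) :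
    ∃ b : Fin k → E, Orthonormal ℂ b ∧ ∀ i, b i ∈ V := by
  refine ⟨fun i => (stdOrthonormalBasis ℂ V (Fin.castLE hk i) : E), ?_,
    fun i => Submodule.coe_mem _⟩
  have h1 : Orthonormal ℂ (⇑(stdOrthonormalBasis ℂ V) ∘ Fin.castLE hk) :=
    (stdOrthonormalBasis ℂ V).orthonormal.comp _ (Fin.castLE_injective hk)
  exact h1.comp_linearIsometry V.subtypeₗᵢ

/-- **Abstract closedness of Fano loci.** Let `E` be a finite-dimensional complex inner product
space, `X` a Fréchet–Urysohn space, `f : X → E → ℂ` jointly continuous, and `S ⊆ X` such that for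
every `c ∈ S` the function `f c` vanishes on some subspace of dimension `≥ k`. Then the same holds
for every `c₀ ∈ closure S`. [folklore] -/
theorem exists_submodule_of_mem_closure {X E : Type*} [TopologicalSpace X] [FrechetUrysohnSpace X]
    [NormedAddCommGroup E] [InnerProductSpace ℂ E] [FiniteDimensional ℂ E]
    (f : X → E → ℂ) (hf : Continuous fun p : X × E => f p.1 p.2) (k : ℕ) (S : Set X)
    (hS : ∀ c ∈ S, ∃ V : Submodule ℂ E, k ≤ Module.finrank ℂ V ∧ ∀ v ∈ V, f c v = 0)
    (c₀ : X) (hc₀ : c₀ ∈ closure S) :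
    ∃ V : Submodule ℂ E, k ≤ Module.finrank ℂ V ∧ ∀ v ∈ V, f c₀ v = 0 := by
  obtain ⟨c, hcS, hc⟩ := mem_closure_iff_seq_limit.mp hc₀
  choose V hV using fun n => hS (c n) (hcS n)
  choose b hb using fun n => exists_orthonormal_of_le_finrank (V n) (hV n).1
  obtain ⟨β, hβ, φ, hφ, hlim⟩ :=
    (isCompact_setOf_orthonormal (E := E) k).tendsto_subseq (x := b) fun n => (hb n).1
  refine ⟨Submodule.span ℂ (Set.range β), ?_, ?_⟩
  · rw [finrank_span_eq_card hβ.linearIndependent, Fintype.card_fin]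
  · intro v hv
    obtain ⟨t, rfl⟩ := (Submodule.mem_span_range_iff_exists_fun ℂ).mp hv
    have hcont : Continuous fun p : X × (Fin k → E) => f p.1 (∑ i, t i • p.2 i) :=
      hf.comp (by fun_prop : Continuous fun p : X × (Fin k → E) => (p.1, ∑ i, t i • p.2 i))
    have h1 : Tendsto (fun n => f (c (φ n)) (∑ i, t i • b (φ n) i)) atTop
        (𝓝 (f c₀ (∑ i, t i • β i))) :=
      (hcont.tendsto (c₀, β)).comp ((hc.comp hφ.tendsto_atTop).prodMk_nhds hlim)
    have h2 : ∀ n, f (c (φ n)) (∑ i, t i • b (φ n) i) = 0 := fun n =>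
      (hV (φ n)).2 _ (Submodule.sum_mem _ fun i _ => Submodule.smul_mem _ _ ((hb (φ n)).2 i))
    simp only [h2] at h1
    exact tendsto_nhds_unique h1 tendsto_const_nhds

/-- **S3 — the Fano locus is classically closed** (abstract): let `F` be a finite set of exponents
on a finite variable type `σ`, `k : ℕ`, and `S` a set of coefficient vectors `c : F → ℂ` each of
whose polynomials `Σ_{μ ∈ F} c_μ x^μ` vanishes identically on some linear subspace of dimension
`≥ k`; then the same holds for every `c₀` in the classical closure of `S`. (Transport of
`exists_submodule_of_mem_closure` along `EuclideanSpace.equiv σ ℂ`.) [folklore] -/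
theorem stub_fanoClosed : ∀ {σ : Type} [Fintype σ] [DecidableEq σ] (F : Finset (σ →₀ ℕ)) (k : ℕ) (S : Set (↥F → ℂ)), (∀ c ∈ S, ∃ V : Submodule ℂ (σ → ℂ), k ≤ Module.finrank ℂ V ∧ ∀ v ∈ V, ∑ μ : ↥F, c μ * ∏ i, v i ^ (μ.1 i) = 0) → ∀ c₀ : ↥F → ℂ, c₀ ∈ closure S → ∃ V : Submodule ℂ (σ → ℂ), k ≤ Module.finrank ℂ V ∧ ∀ v ∈ V, ∑ μ : ↥F, c₀ μ * ∏ i, v i ^ (μ.1 i) = 0 := by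
  intro σ _ _ F k S hS c₀ hc₀
  have e : EuclideanSpace ℂ σ ≃L[ℂ] (σ → ℂ) := EuclideanSpace.equiv σ ℂ
  have hf : Continuous fun p : (↥F → ℂ) × EuclideanSpace ℂ σ =>
      ∑ μ : ↥F, p.1 μ * ∏ i, e p.2 i ^ (μ.1 i) := by
    fun_prop
  obtain ⟨V, hkV, hV⟩ := exists_submodule_of_mem_closure
    (fun (c : ↥F → ℂ) (w : EuclideanSpace ℂ σ) => ∑ μ : ↥F, c μ * ∏ i, e w i ^ (μ.1 i)) hf k S
    (fun c hc => by
      obtain ⟨V, hkV, hV⟩ := hS c hc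
      refine ⟨V.map (e.symm.toLinearEquiv : (σ → ℂ) →ₗ[ℂ] EuclideanSpace ℂ σ), ?_, ?_⟩
      · rwa [LinearEquiv.finrank_map_eq]
      · rintro w ⟨v, hv, rfl⟩
        simpa using hV v hv)
    c₀ hc₀
  refine ⟨V.map (e.toLinearEquiv : EuclideanSpace ℂ σ →ₗ[ℂ] (σ → ℂ)), ?_, ?_⟩
  · rwa [LinearEquiv.finrank_map_eq]
  · rintro v ⟨w, hw, rfl⟩
    simpa using hV w hw

end Summit.ValiantsHypothesis.ValiantsHypothesis.Theorems.RefutationDegreeBeyondHessianNs
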